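import Mathlib
import Literature.Computability.AlgebraicComplexity.ArithCircuitProofs
import Summits.ValiantsHypothesis.ValiantsHypothesis.Theorems.TriangularDimersDivisionEasy.Negative.FalseWithoutDivision
import Summits.ValiantsHypothesis.ValiantsHypothesis.Theorems.DivisionGapTriangularDimersDivisionEasyStubFreeInitialForms
import Summits.ValiantsHypothesis.ValiantsHypothesis.Theorems.DivisionGapTriangularDimersDivisionEasyStubFaceLow
import Summits.ValiantsHypothesis.ValiantsHypothesis.Theorems.DivisionGapTriangularDimersDivisionEasyStubPmSum
import Summits.ValiantsHypothesis.ValiantsHypothesis.Theorems.DivisionGapTriangularDimersDivisionEasyStubBoundAbsorb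
import Summits.ValiantsHypothesis.ValiantsHypothesis.Theorems.DivisionGapTriangularDimersDivisionEasyStubSwapIdentity
import Summits.ValiantsHypothesis.ValiantsHypothesis.Theorems.DivisionGapTriangularDimersDivisionEasyStubSubstIdentity
import Summits.ValiantsHypothesis.ValiantsHypothesis.Theorems.DivisionGapTriangularDimersDivisionEasyStubEvenTransfer

/-!
# Crux `DivisionGap.TriangularDimersDivisionEasy` (stmt-ValiantsHypothesis-5067), line `Sketch` — WITHOUT division both
Ising polynomials of the line are monotone-HARD (registered helper stubs `oddJoin_not_monotoneEasy`, `evenSplit_not_monotoneEasy`)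

Valiant's exponential monotone lower bound for the dimer polynomial `D_n` of the triangular rhombus
(`Negative.not_monotoneEasyWithoutDivision`, the standing disprover's §E, in tree) transfers FOR FREE along the
line's two reductions, because both are built from operations that cost (almost) nothing for monotone circuits:
taking a lowest homogeneous component (`Shuffling.stub_freeInitialForms`), renaming variables along a permutation
(`complexity_rename_of_injective`), and substituting `≤ 2`-gate polynomials (`complexity_aeval_le`).  Hence, in the
tree's fan-in-two monotone circuit model over `ℝ≥0` and with the crux's quasi-polynomial threshold
`bound c n = 2 ^ ((log₂ n + c) ^ c)`:

* `oddJoin_not_monotoneEasy : ¬ ∃ c, ∀ n, complexity (oddJoin n) ≤ bound c n` — the all-spin Ising correlator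
  numerators `Σ_{J odd} y^J Π_{e∉J}(1+y_e)` of the triangular rhombi need super-quasi-polynomial monotone circuits;
* `evenSplit_not_monotoneEasy : ¬ ∃ c, ∀ n, complexity (evenSplit n) ≤ bound c n` — so do the EVEN-SUBGRAPH
  (cycle-space / high-temperature, equivalently: sourceless ferromagnetic Ising in split Boltzmann variables)
  polynomials `Σ_{H even} Π_{e∈H} x_e Π_{e∉H} x_(e.swap)`.

So both statements the crux was reduced to (`DivEasy oddJoin`, `DivEasy evenSplit`, file `…Reductions`) sit in exactly
the regime of the crux itself: false without the denominator `h`, open with it.  No `def` is declared.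
[cite: Valiant1980, §3 Thm 1]
-/

-- `Summit.ValiantsHypothesis.ValiantsHypothesis.…` is the tree's mandated single-conjunct layout (Sub = Summit).
set_option linter.dupNamespace false

namespace Summit.ValiantsHypothesis.ValiantsHypothesis.Theorems.TriangularDimersDivisionEasy.OddJoin

open scoped BigOperators NNReal
open Finset MvPolynomial Literature.Computability.AlgebraicComplexity

noncomputable section

/-- **Registered helper `oddJoin_not_monotoneEasy`**: without division the odd-join polynomials of the triangular rhombi
are not quasi-polynomially monotone-easy — their degree-`n²` face is `D_n` (`stub_faceCoeffLow` ∘ `stub_pmSum`), faces are free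
(`Shuffling.stub_freeInitialForms`), and `D_n` is monotone-hard (`Negative.not_monotoneEasyWithoutDivision`).
[cite: Valiant1980, §3 Thm 1] -/
theorem oddJoin_not_monotoneEasy : ¬ ∃ c : ℕ, ∀ n : ℕ, complexity (oddJoin n) ≤ bound c n := by
  rintro ⟨c, hc⟩
  refine Negative.not_monotoneEasyWithoutDivision ⟨c, fun n => ?_⟩
  have hw := stub_oddJoinWeights n
  have hface := (stub_faceCoeffLow n).trans (stub_pmSum n)
  have h1 : complexity (weightedHomogeneousComponent (fun _ => (1 : ℕ)) (n * n) (oddJoin n)) ≤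
      complexity (oddJoin n) :=
    Shuffling.stub_freeInitialForms (Var n) (fun _ => (1 : ℕ)) (n * n) (oddJoin n) hw
  rw [hface] at h1
  exact h1.trans (hc n)

/-- **Registered helper `evenSplit_not_monotoneEasy`**: without division the even-subgraph polynomials of the triangular
rhombi (split variables) are not quasi-polynomially monotone-easy — for even `n` the free swap along `pm0 n` and the
`≤ 2`-gate chart map carry `evenSplit n` to `oddJoin n` at cost `+ 2 n⁴` (`stub_swapIdentity`, `stub_substIdentity`,
`EvenTransfer.complexity_aeval_substY_le`), absorbed by `stub_boundAbsorb`; odd `n` is free (`oddJoin n = 0`).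
[cite: Valiant1980, §3 Thm 1] -/
theorem evenSplit_not_monotoneEasy : ¬ ∃ c : ℕ, ∀ n : ℕ, complexity (evenSplit n) ≤ bound c n := by
  rintro ⟨c, hc⟩
  obtain ⟨c', hc'⟩ := stub_boundAbsorb c 2 4
  refine oddJoin_not_monotoneEasy ⟨c', fun n => ?_⟩
  rcases Nat.even_or_odd n with hn | hn
  · have hS := stub_swapIdentity n hn
    have hφ := stub_substIdentity n
    have h1 : complexity (oddJoinSplit n) = complexity (evenSplit n) := by
      rw [← hS]
      exact complexity_rename_of_injective_holds (swapVar n).injective _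
    have h2 : complexity (oddJoin n) ≤ complexity (oddJoinSplit n) + 2 * n ^ 4 := by
      rw [← hφ.1]
      exact EvenTransfer.complexity_aeval_substY_le hφ.2 _
    have h3 := hc n
    have h4 := hc' n
    omega
  · rw [EvenTransfer.oddJoin_eq_zero hn, ← C_0, complexity_C_holds]
    exact Nat.zero_le _

end

end Summit.ValiantsHypothesis.ValiantsHypothesis.Theorems.TriangularDimersDivisionEasy.OddJoin
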